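import Summits.ABC.ABC.Theses.IsogenyGlueCongruence
import Literature.NumberTheory.EllipticCurves.PastenSpectralDegreeIsogenyBoundProofs

/-!
# `MazurKenkuBound` (stmt-ABC-15125) · Negative · hypothesis (ii) is redundant; the divisibility form

Same provenance as `LoadBearing.lean` (standing disprover's work file
`Cruxes/MazurKenkuBound/Disproof.lean`, refuter-cdisprove-stmt-ABC-15125-0, cycle 1, 2026-08-16);
independent of it. Sorry-free; no theorem asserts a Theses decl positively (the two `iff`s restate
the crux, they do not prove it).

* `mazurKenkuBound_iff_withoutDMin` — hypothesis (ii) (class-minimality of `D` among ALL data with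
  the same newform) is REDUNDANT: the crux is equivalent to the same statement without it
  (well-ordering of `ℕ`; no input). Provers may ignore `hmin`; the tree's reduction
  `PastenShimura2024_minimalDegree_le_163_mul_of` already binds it as `_`.
* `modularDegree_dvd_of_classMinimal` — the divisibility `deg D ∣ deg D'` holds UNCONDITIONALLY under
  (i)+(ii) alone: `deg D = δ` (the Eichler–Shimura degree; `exists_optimalDatum'`,
  `degree_eichlerShimuraMap_le_modularDegree`) and `deg D' = [Λ_{E'} : c'Λ_f] · δ` (degree formula).
* `mazurKenkuBound_iff_hMK` — pointer: the open content of the crux is exactly the cofactor bound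
  `hMK` (tree `PastenShimura2024_minimalDegree_le_163_mul_iff`) = Mazur–Kenku
  (`mazurKenku_exists_cyclic_isogeny`) + Néron integrality `hInt`; in print the cofactor of a minimal
  datum is the degree of the minimal cyclic `ℚ`-isogeny `E_f → E'`, an element of Kenku's list
  `{1,…,19,21,25,27,37,43,67,163}` (natural strengthening: `deg D' / deg D ∈ kenkuDegrees`).

## References

* B. Mazur, *Rational isogenies of prime degree*, Invent. Math. 44 (1978), 129–162: Thm. 1. [Mazur1978]
* M. A. Kenku, *On the number of ℚ-isomorphism classes of elliptic curves in each ℚ-isogeny class*,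
  J. Number Theory 15 (1982), 199–202. [Kenku1982]
* H. Pasten, *Shimura curves and the abc conjecture*, J. Number Theory 254 (2024), 214–335: §3 p. 13.
  [PastenShimura2024]
* J. H. Silverman, *The Arithmetic of Elliptic Curves*, 2nd ed., GTM 106 (2009): III.1 Table 3.1,
  Thm. VI.4.1. [SilvermanAEC2009]
-/

-- `Summit.ABC.ABC` is the mandated summit-side namespace (CONVENTIONS §2); the duplicate is
-- deliberate.
set_option linter.dupNamespace false

noncomputable section
namespace Summit.ABC.ABC.Theorems.MazurKenkuBound.Negative

open Literature.NumberTheory.EllipticCurves.ModularForms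
open Summit.ABC.ABC.Theses.IsogenyGlueCongruence
open scoped MatrixGroups ModularForm
open CongruenceSubgroup

/-! ## Hypothesis (ii): redundant -/

/-- `MazurKenkuBound` with hypothesis (ii) — "`D` has minimal degree among ALL data with the same
newform" — DROPPED. -/
def MazurKenkuBoundWithoutDMin : Prop :=
  ∀ (N : ℕ) [NeZero N] (W W' : WeierstrassCurve ℚ) [W.IsElliptic] [W'.IsElliptic]
    [W'.IsGloballyMinimal] (D : ModularParametrizationData W N)
    (D' : ModularParametrizationData W' N), D'.f = D.f →
    (∀ D'' : ModularParametrizationData W' N, D'.modularDegree ≤ D''.modularDegree) →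
    D'.modularDegree ≤ 163 * D.modularDegree

/-- **Hypothesis (ii) is redundant**: `MazurKenkuBound ↔ MazurKenkuBoundWithoutDMin`, with no
input at all (well-ordering of `ℕ`: replace `D` by a datum of least degree in the class, which
satisfies (ii), and use `deg D₀ ≤ deg D`). Information for the prover: any proof may ignore
`hmin`; the tree's reduction `PastenShimura2024_minimalDegree_le_163_mul_of` already binds it as `_`. -/
theorem mazurKenkuBound_iff_withoutDMin : MazurKenkuBound ↔ MazurKenkuBoundWithoutDMin := by
  classical
  refine ⟨fun h ↦ ?_, fun h ↦ ?_⟩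
  · intro N _ W W' _ _ _ D D' hf hmin'
    have hex : ∃ n, ∃ (W'' : WeierstrassCurve ℚ) (_ : W''.IsElliptic)
        (D'' : ModularParametrizationData W'' N), D''.f = D.f ∧ D''.modularDegree = n :=
      ⟨_, W, ‹_›, D, rfl, rfl⟩
    obtain ⟨W₀, hW₀, D₀, hf₀, hdeg₀⟩ := Nat.find_spec hex
    haveI := hW₀
    have hmin₀ : ∀ (W'' : WeierstrassCurve ℚ) [W''.IsElliptic]
        (D'' : ModularParametrizationData W'' N), D''.f = D₀.f →
          D₀.modularDegree ≤ D''.modularDegree := fun W'' _ D'' hD'' ↦ by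
      rw [hdeg₀]
      exact Nat.find_min' hex ⟨W'', ‹_›, D'', hD''.trans hf₀, rfl⟩
    have h1 : D'.modularDegree ≤ 163 * D₀.modularDegree :=
      h N W₀ W' D₀ D' (hf.trans hf₀.symm) hmin₀ hmin'
    have h2 : D₀.modularDegree ≤ D.modularDegree := hmin₀ W D hf₀.symm
    calc D'.modularDegree ≤ 163 * D₀.modularDegree := h1
      _ ≤ 163 * D.modularDegree := Nat.mul_le_mul_left 163 h2
  · intro N _ W W' _ _ _ D D' hf _ hmin'
    exact h N W W' D D' hf hmin'

/-! ## (c) The TRUE sharper form: divisibility (unconditional) — and what exactly is open -/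

/-- **Divisibility form, proved.** Under hypotheses (i) `D'.f = D.f` and (ii) (class-minimality of
`D`) alone — no minimality of `D'`, no `IsGloballyMinimal` — `deg D ∣ deg D'`: `deg D = δ` (the
Eichler–Shimura degree; an optimal datum of degree `δ` exists, `exists_optimalDatum'`, and
`δ ≤ deg` of every datum) and `deg D' = [Λ_{E'} : c' Λ_f] · δ` (degree formula). So the crux is
EQUIVALENT to: the cofactor `[Λ_{E'} : c' Λ_f]` of a minimal datum of a globally minimal `W'` is
`≤ 163` — the tree's `PastenShimura2024_minimalDegree_le_163_mul_iff` (hMK) — and in print that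
cofactor is the degree of the minimal (cyclic) `ℚ`-isogeny `E_f → E'`, an element of Kenku's list
`{1,…,19,21,25,27,37,43,67,163}`; natural strengthening for provers: `deg D' / deg D ∈ kenkuDegrees` (Kenku 1982). [folklore] -/
theorem modularDegree_dvd_of_classMinimal {N : ℕ} [NeZero N] {W W' : WeierstrassCurve ℚ}
    [W.IsElliptic] (D : ModularParametrizationData W N) (D' : ModularParametrizationData W' N)
    (hf : D'.f = D.f)
    (hmin : ∀ (W'' : WeierstrassCurve ℚ) [W''.IsElliptic] (D'' : ModularParametrizationData W'' N),
      D''.f = D.f → D.modularDegree ≤ D''.modularDegree) :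
    D.modularDegree ∣ D'.modularDegree := by
  have hf0 : D.f ≠ 0 := D.isNewformOf.1.ne_zero
  haveI := discreteTopology_periodLattice_of_mul_mem D.f D.cast_c_ne_zero D.smul_periodLattice_le
  obtain ⟨δ, hδ, hfinδ⟩ := exists_degree_eichlerShimuraMap' (N := N) hf0
  obtain ⟨W₀, hW₀, D₀, hf₀, h₀⟩ := D.exists_optimalDatum'
  haveI := hW₀
  have hker₀ : D₀.isogenyMap.ker = ⊥ := D₀.isogenyMap_ker_eq_bot_iff.mpr h₀
  have hdeg₀ : D₀.modularDegree = δ := by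
    obtain ⟨-, h⟩ := D₀.modularDegree_eq_card_ker_mul_of_eichlerShimuraMap hf₀ hδ hfinδ
    rw [h, hker₀, AddSubgroup.card_bot, one_mul]
  have hD : D.modularDegree = δ :=
    le_antisymm (hdeg₀ ▸ hmin W₀ D₀ hf₀) (D.degree_eichlerShimuraMap_le_modularDegree rfl hδ hfinδ)
  obtain ⟨-, hdeg'⟩ := D'.modularDegree_eq_card_ker_mul_of_eichlerShimuraMap hf hδ hfinδ
  rw [hD, hdeg']
  exact Dvd.intro_left _ rfl

/-- **What is open, exactly (pointer, proved in the tree).** The crux is definitionally the vendored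
fact and that fact is equivalent to the Néron-lattice form `hMK` of Mazur–Kenku
(`PastenShimura2024_minimalDegree_le_163_mul_iff`); its two printed inputs are the named fact
`mazurKenku_exists_cyclic_isogeny` (Mazur 1978 Thm 1 + Kenku 1982) and the integrality `hInt` of
rational multipliers into the Néron lattice of a globally minimal parametrised curve
(`PastenShimura2024_minimalDegree_le_163_mul_of_mazurKenku`). The two `_false_without_` theorems
of `LoadBearing.lean` say that BOTH inputs are used essentially: dropping `IsGloballyMinimal` kills `hInt`
(multiplier `1/13`), dropping `hmin'` kills the passage to a MINIMAL isogeny. [folklore] -/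
theorem mazurKenkuBound_iff_hMK :
    MazurKenkuBound ↔
      ∀ {N : ℕ} [NeZero N] {W' : WeierstrassCurve ℚ} [W'.IsElliptic] [W'.IsGloballyMinimal]
        (D' : ModularParametrizationData W' N),
        ∃ (k : ℤ) (hk : ∀ z ∈ periodLattice D'.f, (k : ℂ) * z ∈ D'.L.lattice), k ≠ 0 ∧
          Nat.card (mulQuotientMap (periodLattice D'.f) D'.L.lattice.toAddSubgroup (k : ℂ) hk).ker
            ≤ 163 :=
  PastenShimura2024_minimalDegree_le_163_mul_iff

end Summit.ABC.ABC.Theorems.MazurKenkuBound.Negative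

end
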